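import Literature.NumberTheory.Automorphic.ArchInnerFormCartanAtlas
import Literature.LinearAlgebra.Matrix.Diagonalization
import HarnessLib

/-!
# Eigenframe Gram matrices in the inner form `G′_w = U(diag a)(ℂ)`: pairing of eigenvalues, transport of frames, signs
# ((EXH-G′) algebra layer; Rogawski 1990 §3.6; Knapp 1986 V §3; Horn–Johnson Thm 1.3.9 ∕ 4.5.8)

Topic `NumberTheory/Automorphic`; namespace `Literature.NumberTheory.Automorphic.UnitaryGroup`.  THEOREMS ONLY (no `def`, no instance, no notation, no axiom, no
named fact, no `sorry`).  Cell `pub/hodgecm-mathlib`, crux H413 (`stmt-HodgeConjecture-24833`), F0∕P3c line LH3, DIRECT ROAD of `stub_N9`; organ **(EXH-G′)** of LH3-plan (g2)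
(2026-09-02T06:28:37Z (4), LH3-p03 (g2) census P2): the rank-3 twin of ★ (DICH) `exists_conj_torusMatrix_or_diagonal_archLocal` ∕ ★ (EXH-H) `exists_conj_endoTorus_of_isArchGRegular`,
ALGEBRA layer (generic `n × n` Gram relations + the `3 × 3` sign∕boost bookkeeping); the place normal form is the sequel `ArchInnerFormPlaceNormalForm`, the
`G′_∞`-assembly `ArchInnerFormChartExhaustion`.  Seat LH7-p01 (g2).  Count-neutral.

THE MATHEMATICS (one complex place; `D = diag(a)`, `a : Fin 3 → ℝ`, `a_i ≠ 0`; `γᴴ D γ = D`, `charpoly γ` separable).  Diagonalise `γ S = S·diag(d)` in `GL₃(ℂ)`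
(★ `exists_conj_eq_diagonal_of_nodup_roots'`), `d` injective, and read the GRAM MATRIX `G = Sᴴ D S` of the eigenbasis: `γ ∈ U(D)` gives `diag(d)ᴴ G diag(d) = G`, i.e.
**`(d̄_i d_j − 1) G_{ij} = 0`** (`gram_entry_eq_zero_of_ne_one`), and `G` is invertible, so every row of `G` has a nonzero entry: for each `i` some `j` with `d̄_i d_j = 1`.
* If every `|d_i| = 1` then `G` is DIAGONAL with real nonzero entries `n_i`, and the signs of `(n_i)` are those of `(a_ℓ)` up to order (`det G = |det S|² det D` fixes the
  parity; definiteness transfers both ways); rescaling the eigenvectors and ordering them by sign gives `g ∈ U(D)` with `g⁻¹ γ g` a UNIT DIAGONAL = `gprimeCptGL τ c`.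
* Otherwise some `|d_{i₀}| ≠ 1`; its row pairs with a unique `j₀ ≠ i₀` (`d̄_{i₀} d_{j₀} = 1`), both eigenlines are ISOTROPIC and orthogonal to the third, `k₀`, with
  `|d_{k₀}| = 1`, `n = G_{k₀k₀} ≠ 0`, `m = G_{i₀j₀} ≠ 0`; so `D` is indefinite (the place is a split-chart place), `sgn n` is the majority sign (`det`), and matching
  the Gram matrix `(0 0 −2b₂; 0 b₁ 0; −2b₂ 0 0)` of the boost eigenframe ★ `cayB` (`b = a ∘ τ`) by the scalings `(1, √(b₁∕n), −2b₂∕m)` gives `g ∈ U(D)` with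
  `g⁻¹ γ g = gprimeSplitMatrix τ a (x, φ, θ)`, `e^{x+iθ} = d_{i₀}` (`x = log |d_{i₀}| ≠ 0`), `e^{iφ} = d_{k₀}`.
The conjugator is produced by the TRANSPORT LEMMA `conjTranspose_mul_of_gram_eq` ∕ `mul_eq_mul_of_frames` («two frames with the same Gram matrix intertwining the
same diagonal»).
* §1 Gram relations (`gram_entry_mul_eq`, `gram_entry_eq_zero_of_ne_one`, `exists_gram_ne_zero`, `exists_conj_mul_eq_one`, `det_gram`, frame moves `mul_submatrix_eq` ∕
  `mul_mul_diagonal_eq` ∕ `gram_submatrix` ∕ `gram_mul_diagonal_apply`), transport `conjTranspose_mul_of_gram_eq` ∕ `mul_eq_mul_of_frames`;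
* §2 diagonal Gram entries of a diagonal real form (`gram_diag_eq_sum`, `gram_diag_re_pos`, `gram_diag_re_neg`), the inverse frame (`conjTranspose_inv_mul_gram_mul_inv`),
  the sign-matching permutation (`exists_perm_sign_comp_eq`, by `decide`), the third index of `Fin 3` (`exists_third`); the Gram matrix of the boost
  eigenframe ★ `cayB` is ★ `conjTranspose_cayB_mul_diagonal_mul_cayB` (`ArchInnerFormPlaceNormalFormSplit`, LH3-p03 (g2)).
HONEST LABEL: HC_CM is proved only modulo the 7 printed citations (2 remaining: hLiu418 = `stmt-HodgeConjecture-24832`, h413 = `stmt-HodgeConjecture-24833`) until rung 0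
closes; chart bookkeeping, count-neutral (+0∕+0).

## References
* [Rogawski1990] J. D. Rogawski, *Automorphic Representations of Unitary Groups in Three Variables*, Ann. of Math. Stud. 123 (1990), §3.6 p. 31 (the Cartan subgroups of
  `U(2,1)` and `U(3)`), §3.1 p. 19, §4.3 p. 42.
* [Knapp1986] A. W. Knapp, *Representation Theory of Semisimple Groups* (1986), Ch. V §3 (every regular element lies in a Cartan subgroup; the compact torus and the `MA` torus).
* [HornJohnson2013] R. A. Horn, C. R. Johnson, *Matrix Analysis*, 2nd ed. (2013), Thm 1.3.9 (distinct eigenvalues ⇒ diagonalizable), Thm 4.5.8 (Sylvester's law of inertia).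
-/

set_option autoImplicit false

noncomputable section

open Matrix Complex Polynomial
open scoped MatrixGroups Matrix ComplexConjugate Real

namespace Literature.NumberTheory.Automorphic.UnitaryGroup

/-! ## §1 Gram relations of an eigenframe of `γ ∈ U(D)` and the transport lemma -/

section Gram

variable {n : Type*} [Fintype n] [DecidableEq n]

/-- **`(d̄_i d_j − 1)·G_{ij} = 0`** for the Gram matrix `G = Sᴴ D S` of an eigenframe `γ S = S diag(d)` of `γ ∈ U(D)` (`γᴴ D γ = D`):
`⟨γ v_i, γ v_j⟩ = d̄_i d_j ⟨v_i, v_j⟩ = ⟨v_i, v_j⟩`. [cite: Rogawski1990, §3.6 p. 31] [cite: Knapp1986, Ch. V §3] -/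
theorem gram_entry_mul_eq (D γ S : Matrix n n ℂ) (d : n → ℂ) (hγ : γᴴ * D * γ = D) (hS : γ * S = S * Matrix.diagonal d) (i j : n) :
    (starRingEnd ℂ) (d i) * (Sᴴ * D * S) i j * d j = (Sᴴ * D * S) i j := by
  have h1 : (γ * S)ᴴ * D * (γ * S) = Sᴴ * D * S := by
    calc (γ * S)ᴴ * D * (γ * S) = Sᴴ * (γᴴ * D * γ) * S := by rw [Matrix.conjTranspose_mul]; simp only [Matrix.mul_assoc]
      _ = Sᴴ * D * S := by rw [hγ]
  have h2 : (γ * S)ᴴ * D * (γ * S) = (Matrix.diagonal d)ᴴ * (Sᴴ * D * S) * Matrix.diagonal d := by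
    rw [hS, Matrix.conjTranspose_mul]
    simp only [Matrix.mul_assoc]
  have h := congrFun (congrFun (h2.symm.trans h1) i) j
  rw [Matrix.diagonal_conjTranspose, Matrix.mul_diagonal, Matrix.diagonal_mul] at h
  simpa only [Pi.star_apply, Complex.star_def] using h

/-- Off the relation `d̄_i d_j = 1` the Gram entry vanishes: `d̄_i d_j ≠ 1 → G_{ij} = 0`. [cite: Rogawski1990, §3.6 p. 31] -/
theorem gram_entry_eq_zero_of_ne_one (D γ S : Matrix n n ℂ) (d : n → ℂ) (hγ : γᴴ * D * γ = D) (hS : γ * S = S * Matrix.diagonal d) {i j : n}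
    (hij : (starRingEnd ℂ) (d i) * d j ≠ 1) : (Sᴴ * D * S) i j = 0 := by
  have h := gram_entry_mul_eq D γ S d hγ hS i j
  have h' : ((starRingEnd ℂ) (d i) * d j - 1) * (Sᴴ * D * S) i j = 0 := by rw [sub_mul, one_mul, sub_eq_zero, mul_right_comm, h]
  rcases mul_eq_zero.1 h' with h0 | h0
  · exact absurd (sub_eq_zero.1 h0) hij
  · exact h0

/-- `det (Sᴴ D S) = conj(det S) · det D · det S`. [cite: HornJohnson2013, Thm 4.5.8] -/
theorem det_gram (D S : Matrix n n ℂ) : (Sᴴ * D * S).det = (starRingEnd ℂ) S.det * D.det * S.det := by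
  rw [Matrix.det_mul, Matrix.det_mul, Matrix.det_conjTranspose, Complex.star_def]

/-- The Gram matrix of an invertible frame for an invertible form is invertible. [cite: HornJohnson2013, Thm 4.5.8] -/
theorem isUnit_det_gram {D S : Matrix n n ℂ} (hD : IsUnit D.det) (hS : IsUnit S.det) : IsUnit (Sᴴ * D * S).det := by
  rw [det_gram]
  exact (((RingHom.isUnit_map _ hS)).mul hD).mul hS

/-- **Every row of an invertible Gram matrix has a nonzero entry** (a zero row kills the determinant). [cite: HornJohnson2013, Thm 4.5.8] -/
theorem exists_gram_ne_zero {D S : Matrix n n ℂ} (hD : IsUnit D.det) (hS : IsUnit S.det) (i : n) : ∃ j, (Sᴴ * D * S) i j ≠ 0 := by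
  by_contra h
  push Not at h
  exact (isUnit_det_gram hD hS).ne_zero (Matrix.det_eq_zero_of_row_eq_zero i h)

/-- **Every eigenvalue pairs**: for each `i` there is `j` with `d̄_i d_j = 1` and `G_{ij} ≠ 0`. [cite: Rogawski1990, §3.6 p. 31] [cite: Knapp1986, Ch. V §3] -/
theorem exists_conj_mul_eq_one {D γ S : Matrix n n ℂ} (d : n → ℂ) (hγ : γᴴ * D * γ = D) (hS : γ * S = S * Matrix.diagonal d) (hD : IsUnit D.det)
    (hSu : IsUnit S.det) (i : n) : ∃ j, (starRingEnd ℂ) (d i) * d j = 1 ∧ (Sᴴ * D * S) i j ≠ 0 := by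
  obtain ⟨j, hj⟩ := exists_gram_ne_zero hD hSu i
  by_cases h1 : (starRingEnd ℂ) (d i) * d j = 1
  · exact ⟨j, h1, hj⟩
  · exact absurd (gram_entry_eq_zero_of_ne_one D γ S d hγ hS h1) hj

omit [DecidableEq n] in
/-- The Gram matrix of a hermitian form is hermitian. [cite: HornJohnson2013, Thm 4.5.8] -/
theorem gram_conjTranspose {D : Matrix n n ℂ} (hD : Dᴴ = D) (S : Matrix n n ℂ) : (Sᴴ * D * S)ᴴ = Sᴴ * D * S := by
  rw [Matrix.conjTranspose_mul, Matrix.conjTranspose_mul, Matrix.conjTranspose_conjTranspose, hD, Matrix.mul_assoc]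

omit [DecidableEq n] in
/-- A diagonal Gram entry of a hermitian form is real: `conj G_{ii} = G_{ii}`. [cite: HornJohnson2013, Thm 4.5.8] -/
theorem conj_gram_diag {D : Matrix n n ℂ} (hD : Dᴴ = D) (S : Matrix n n ℂ) (i : n) : (starRingEnd ℂ) ((Sᴴ * D * S) i i) = (Sᴴ * D * S) i i := by
  have h := congrFun (congrFun (gram_conjTranspose hD S) i) i
  rwa [Matrix.conjTranspose_apply, Complex.star_def] at h

/-- Permuting the frame: the columns `v_{σ k}` form an eigenframe for the permuted eigenvalues `d ∘ σ`. [cite: HornJohnson2013, Thm 1.3.9] -/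
theorem mul_submatrix_eq (γ S : Matrix n n ℂ) (d : n → ℂ) (hS : γ * S = S * Matrix.diagonal d) (σ : n ≃ n) :
    γ * S.submatrix id σ = S.submatrix id σ * Matrix.diagonal (d ∘ σ) := by
  ext i k
  have h := congrFun (congrFun hS i) (σ k)
  rw [Matrix.mul_diagonal, Matrix.mul_apply] at h
  rw [Matrix.mul_diagonal, Matrix.mul_apply]
  simpa only [Matrix.submatrix_apply, id_eq, Function.comp_apply] using h

/-- Rescaling the frame: the columns `t_k v_k` form an eigenframe for the same eigenvalues. [cite: HornJohnson2013, Thm 1.3.9] -/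
theorem mul_mul_diagonal_eq (γ S : Matrix n n ℂ) (d : n → ℂ) (hS : γ * S = S * Matrix.diagonal d) (t : n → ℂ) :
    γ * (S * Matrix.diagonal t) = (S * Matrix.diagonal t) * Matrix.diagonal d := by
  rw [← Matrix.mul_assoc, hS, Matrix.mul_assoc, Matrix.mul_assoc, Matrix.diagonal_mul_diagonal, Matrix.diagonal_mul_diagonal]
  congr 2
  funext i
  exact mul_comm _ _

omit [DecidableEq n] in
/-- The Gram matrix of the permuted frame is the re-indexed Gram matrix: `(S P_σ)ᴴ D (S P_σ) = G.submatrix σ σ`. [cite: HornJohnson2013, Thm 4.5.8] -/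
theorem gram_submatrix (D S : Matrix n n ℂ) (σ : n ≃ n) :
    (S.submatrix id σ)ᴴ * D * S.submatrix id σ = (Sᴴ * D * S).submatrix σ σ := by
  ext k l
  simp only [Matrix.mul_apply, Matrix.conjTranspose_apply, Matrix.submatrix_apply, id_eq]

/-- The Gram matrix of the rescaled frame, entrywise: `((S diag t)ᴴ D (S diag t))_{kl} = t̄_k G_{kl} t_l`. [cite: HornJohnson2013, Thm 4.5.8] -/
theorem gram_mul_diagonal_apply (D S : Matrix n n ℂ) (t : n → ℂ) (k l : n) :
    ((S * Matrix.diagonal t)ᴴ * D * (S * Matrix.diagonal t)) k l = (starRingEnd ℂ) (t k) * (Sᴴ * D * S) k l * t l := by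
  have e : (S * Matrix.diagonal t)ᴴ * D * (S * Matrix.diagonal t) = (Matrix.diagonal t)ᴴ * (Sᴴ * D * S) * Matrix.diagonal t := by
    rw [Matrix.conjTranspose_mul]
    simp only [Matrix.mul_assoc]
  rw [e, Matrix.diagonal_conjTranspose, Matrix.mul_diagonal, Matrix.diagonal_mul, Pi.star_apply, Complex.star_def]

/-- **TRANSPORT LEMMA.**  Two invertible frames `E`, `U` with the SAME Gram matrix for `D` and intertwining the same diagonal (`γ E = E Λ`, `M U = U Λ`) give the
`D`-isometry `g = E U⁻¹` (`gᴴ D g = D`) with `γ g = g M`. [cite: Knapp1986, Ch. V §3] [cite: Rogawski1990, §3.6 p. 31] -/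
theorem conjTranspose_mul_of_gram_eq {D E U : Matrix n n ℂ} (hU : IsUnit U.det) (hgram : Eᴴ * D * E = Uᴴ * D * U) :
    (E * U⁻¹)ᴴ * D * (E * U⁻¹) = D := by
  have hUinv : (U⁻¹)ᴴ * Uᴴ = 1 := by
    rw [← Matrix.conjTranspose_mul, Matrix.mul_nonsing_inv _ hU, Matrix.conjTranspose_one]
  calc (E * U⁻¹)ᴴ * D * (E * U⁻¹) = (U⁻¹)ᴴ * (Eᴴ * D * E) * U⁻¹ := by rw [Matrix.conjTranspose_mul]; simp only [Matrix.mul_assoc]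
    _ = ((U⁻¹)ᴴ * Uᴴ) * D * (U * U⁻¹) := by rw [hgram]; simp only [Matrix.mul_assoc]
    _ = D := by rw [hUinv, Matrix.mul_nonsing_inv _ hU, Matrix.one_mul, Matrix.mul_one]

/-- Transport lemma, intertwining half: `γ (E U⁻¹) = (E U⁻¹) M`. [cite: Knapp1986, Ch. V §3] -/
theorem mul_eq_mul_of_frames {γ M E U Λ : Matrix n n ℂ} (hU : IsUnit U.det) (hE : γ * E = E * Λ) (hM : M * U = U * Λ) :
    γ * (E * U⁻¹) = (E * U⁻¹) * M := by
  have h1 : U⁻¹ * M = Λ * U⁻¹ := by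
    calc U⁻¹ * M = U⁻¹ * (M * U) * U⁻¹ := by rw [Matrix.mul_assoc, Matrix.mul_assoc, Matrix.mul_nonsing_inv _ hU, Matrix.mul_one]
      _ = Λ * U⁻¹ := by rw [hM, ← Matrix.mul_assoc, Matrix.nonsing_inv_mul _ hU, Matrix.one_mul]
  rw [← Matrix.mul_assoc, hE, Matrix.mul_assoc, Matrix.mul_assoc, h1]

end Gram


/-! ## §2 Diagonal real forms: diagonal Gram entries, signs, the third index, the boost eigenframe -/

section DiagonalForm

variable {n : Type*} [Fintype n] [DecidableEq n]

/-- **A diagonal Gram entry of a diagonal real form is `∑_j e_j |T_{ji}|²`.** [cite: HornJohnson2013, Thm 4.5.8] -/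
theorem gram_diag_eq_sum (e : n → ℝ) (T : Matrix n n ℂ) (i : n) :
    (Tᴴ * Matrix.diagonal (fun j => (e j : ℂ)) * T) i i = ((∑ j, e j * ‖T j i‖ ^ 2 : ℝ) : ℂ) := by
  rw [Matrix.mul_apply, Complex.ofReal_sum]
  refine Finset.sum_congr rfl fun j _ => ?_
  rw [Matrix.mul_diagonal, Matrix.conjTranspose_apply, Complex.star_def, Complex.ofReal_mul, Complex.ofReal_pow, ← Complex.conj_mul']
  ring

/-- A column of an invertible matrix is nonzero. [cite: HornJohnson2013, Thm 1.3.9] -/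
theorem exists_apply_ne_zero_of_isUnit_det {T : Matrix n n ℂ} (hT : IsUnit T.det) (i : n) : ∃ j, T j i ≠ 0 := by
  by_contra h
  push Not at h
  exact hT.ne_zero (Matrix.det_eq_zero_of_column_eq_zero i h)

/-- **Positive definite diagonal form ⇒ positive diagonal Gram entries** (for an invertible frame). [cite: HornJohnson2013, Thm 4.5.8] -/
theorem gram_diag_re_pos {e : n → ℝ} (he : ∀ j, 0 < e j) {T : Matrix n n ℂ} (hT : IsUnit T.det) (i : n) :
    0 < ((Tᴴ * Matrix.diagonal (fun j => (e j : ℂ)) * T) i i).re := by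
  rw [gram_diag_eq_sum, Complex.ofReal_re]
  obtain ⟨j, hj⟩ := exists_apply_ne_zero_of_isUnit_det hT i
  exact Finset.sum_pos' (fun k _ => mul_nonneg (he k).le (sq_nonneg _)) ⟨j, Finset.mem_univ j, mul_pos (he j) (pow_pos (norm_pos_iff.2 hj) 2)⟩

/-- **Negative definite diagonal form ⇒ negative diagonal Gram entries** (for an invertible frame). [cite: HornJohnson2013, Thm 4.5.8] -/
theorem gram_diag_re_neg {e : n → ℝ} (he : ∀ j, e j < 0) {T : Matrix n n ℂ} (hT : IsUnit T.det) (i : n) :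
    ((Tᴴ * Matrix.diagonal (fun j => (e j : ℂ)) * T) i i).re < 0 := by
  rw [gram_diag_eq_sum, Complex.ofReal_re]
  obtain ⟨j, hj⟩ := exists_apply_ne_zero_of_isUnit_det hT i
  have hlt : ∑ k, e k * ‖T k i‖ ^ 2 < ∑ k, (0 : ℝ) :=
    Finset.sum_lt_sum (fun k _ => mul_nonpos_of_nonpos_of_nonneg (he k).le (sq_nonneg _))
      ⟨j, Finset.mem_univ j, mul_neg_of_neg_of_pos (he j) (pow_pos (norm_pos_iff.2 hj) 2)⟩
  simpa using hlt

/-- **The inverse frame reads the form from the Gram matrix**: `(S⁻¹)ᴴ (Sᴴ D S) S⁻¹ = D`. [cite: HornJohnson2013, Thm 4.5.8] -/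
theorem conjTranspose_inv_mul_gram_mul_inv (D : Matrix n n ℂ) {S : Matrix n n ℂ} (hS : IsUnit S.det) :
    (S⁻¹)ᴴ * (Sᴴ * D * S) * S⁻¹ = D := by
  have h1 : (S⁻¹)ᴴ * Sᴴ = 1 := by rw [← Matrix.conjTranspose_mul, Matrix.mul_nonsing_inv _ hS, Matrix.conjTranspose_one]
  calc (S⁻¹)ᴴ * (Sᴴ * D * S) * S⁻¹ = ((S⁻¹)ᴴ * Sᴴ) * D * (S * S⁻¹) := by simp only [Matrix.mul_assoc]
    _ = D := by rw [h1, Matrix.mul_nonsing_inv _ hS, Matrix.one_mul, Matrix.mul_one]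

end DiagonalForm

section Three

/-- **Sign matching on `Fin 3`**: two nowhere-zero sign vectors with the same product, both all-positive or neither, both all-negative or neither, differ by a
permutation (the signature count of Sylvester's law in dimension `3`). [cite: HornJohnson2013, Thm 4.5.8] -/
theorem exists_perm_sign_comp_eq : ∀ f g : Fin 3 → SignType, (∀ i, f i ≠ 0) → (∀ i, g i ≠ 0) → f 0 * f 1 * f 2 = g 0 * g 1 * g 2 →
    ((∀ i, f i = 1) ↔ ∀ i, g i = 1) → ((∀ i, f i = -1) ↔ ∀ i, g i = -1) → ∃ σ : Equiv.Perm (Fin 3), ∀ ℓ, f (σ ℓ) = g ℓ := by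
  decide

/-- The third element of `Fin 3`. [cite: HornJohnson2013, Thm 1.3.9] -/
theorem exists_third : ∀ i j : Fin 3, i ≠ j → ∃ k : Fin 3, k ≠ i ∧ k ≠ j ∧ ∀ l : Fin 3, l = i ∨ l = j ∨ l = k := by
  decide

end Three

end Literature.NumberTheory.Automorphic.UnitaryGroup

end
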